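import Summits.KontsevichZagierPeriods.KontsevichZagierPeriods.Theses.HurwitzMicroSectors
import Literature.NumberTheory.Transcendental.PeriodsWave0

/-!
# Sketch (crux-ideate round 1, ideator 2) — crux `HurwitzSectorComplement` (stmt-KontsevichZagierPeriods-14341)

First lemmas of the two idea cards, typed over existing declarations (no proofs, no skeleton):

* Idea `galois-parity-half` (§1): the (−1)^w-symmetric (Bernoulli-parity) half of EVERY rung (w, N)
  closes unconditionally — `SymmetricTowerSector`; its rigidity core `ChowlaOkadaLindemann`
  (Chowla 1970 / Okada 1981 argument: Galois equivariance of ev/π^w + L(w,χ) ≠ 0 + Lindemann);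
  its reduction half `SymReduction` (dilations = distribution relations, item DilationMove PROVED);
  corollaries of the parity ledger with non-constructive inputs (`UniformOddLevelTwo`, `zudilinRungs`).
* Idea `chebyshev-level-deformation` (§2): deform the root of unity to 1 along c = cos u with the
  rational certificate ∂_c T = ∂_s (s·U) — `LadderStepT`, `LadderStepU`; the logarithmic bottom is the
  hub's Clausen arc representation — `CatalanClausenJunction` (all three reps ℚ-rational); the first
  ℚ̄-twisted instance outside the box tower — `GoldenTwistInstance`.
-/

noncomputable section

set_option linter.dupNamespace false

open Set MeasureTheory
open scoped BigOperators
open Literature.NumberTheory.Transcendental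

namespace Summit.KontsevichZagierPeriods.KontsevichZagierPeriods.Cruxes.HurwitzSectorComplement.SketchIdeator2

open Summit.KontsevichZagierPeriods.KontsevichZagierPeriods.Theses.HurwitzMicroSectors

/-- The open unit box `(0,1)ⁿ`. [folklore] -/
def box (n : ℕ) : Set (Fin n → ℝ) := {x | ∀ i, x i ∈ Ioo (0:ℝ) 1}

/-- The product coordinate `t = ∏ xᵢ` of a micro-sector. [folklore] -/
def tOf {n : ℕ} (x : Fin n → ℝ) : ℝ := ∏ i, x i

/-! ## §0 Read-back of the crux -/

theorem crux_iff :
    HurwitzSectorComplement ↔ (SectorTwoSix → AperySectorThreeTwo → NormalFormPrinciple) := Iff.rfl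

/-! ## §1 Idea `galois-parity-half` -/

/-- Bernoulli-parity (symmetric) integrand of weight `w`, level `N`:
`Q(t) + (S(t) + (−1)^w t^{N−2} S(1/t) + [w even] p t^{N−1}) / (1 − t^N)`, `deg S ≤ N − 2`.
Its residue vector is `(−1)^w`-symmetric under `r ↦ N − 2 − r`, so its value lies in
`ℚ + π^w · ℚ(ζ_N)^+`. [folklore] -/
def symIntegrand (w N : ℕ) (Q S : Polynomial ℚ) (p : ℚ) (t : ℝ) : ℝ :=
  Polynomial.aeval t Q +
    (Polynomial.aeval t S + (-1 : ℝ) ^ w * Polynomial.aeval t (Polynomial.reflect (N - 2) S) +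
      (if Even w then (p : ℝ) * t ^ (N - 1) else 0)) / (1 - t ^ N)

/-- `r` is a symmetric micro-sector representation of weight `w`, level `N`. [folklore] -/
def IsSymRep (w N : ℕ) (r : KZ.IntegralRep w) : Prop :=
  ∃ (Q S : Polynomial ℚ) (p : ℚ), S.natDegree ≤ N - 2 ∧ r.domain = box w ∧
    EqOn r.integrand (fun x => symIntegrand w N Q S p (tOf x)) r.domain

/-- **K1 (headline of idea 1).** Conjecture 1 holds, unconditionally, for every pair of symmetric
micro-sector representations of any weights `w, w' ≥ 2` and levels `N, N' ≥ 1`. [folklore] -/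
def SymmetricTowerSector : Prop :=
  ∀ (w N w' N' : ℕ), 2 ≤ w → 1 ≤ N → 2 ≤ w' → 1 ≤ N' →
    ∀ (r : KZ.IntegralRep w) (r' : KZ.IntegralRep w'), IsSymRep w N r → IsSymRep w' N' r' →
      r.value = r'.value → KZ.Equivalent r r'

/-- The symmetric Hurwitz value `g_w(a/N) = Σ_{n ∈ ℤ} (n + a/N)^{-w}`
(`= ζ(w, a/N) + (−1)^w ζ(w, 1 − a/N) = ((-1)^{w-1}/(w-1)!) (d/dx)^{w-1} (π cot πx) |_{x = a/N}`). [folklore] -/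
def gsym (w N a : ℕ) : ℝ := ∑' n : ℤ, 1 / ((n : ℝ) + (a : ℝ) / (N : ℝ)) ^ w

/-- Primitive residues `a` with `0 < a < N/2`, `gcd(a, N) = 1` (a set of representatives of
`(ℤ/N)ˣ/±1`). [folklore] -/
def PrimHalf (N : ℕ) : Type := {a : Fin N // 0 < a.val ∧ 2 * a.val < N ∧ Nat.Coprime a.val N}

instance (N : ℕ) : Fintype (PrimHalf N) := by unfold PrimHalf; infer_instance

/-- **K2 (rigidity core, Chowla–Okada + Lindemann).** For `w ≥ 2`, `N ≥ 3` the real numbers `1` and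
`g_w(a/N)`, `a ∈ PrimHalf N`, are `ℚ`-linearly independent. [Okada 1981 (Acta Arith. 38) Thm;
Chowla 1970; for `w ≥ 2` the input `L(w, χ) ≠ 0` is the Euler product] -/
def ChowlaOkadaLindemann : Prop :=
  ∀ (w N : ℕ), 2 ≤ w → 3 ≤ N →
    LinearIndependent ℚ (fun o : Option (PrimHalf N) => o.elim (1 : ℝ) (fun a => gsym w N a.1.val))

/-- Normal-form integrand on the primitive symmetric basis:
`c + Σ_a μ_a (t^{a−1} + (−1)^w t^{N−1−a}) / (1 − t^N)`; value `c + N^{-w} Σ_a μ_a g_w(a/N)`. [folklore] -/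
def nfIntegrand (w N : ℕ) (c : ℚ) (μ : PrimHalf N → ℚ) (t : ℝ) : ℝ :=
  (c : ℝ) + ∑ a : PrimHalf N,
    (μ a : ℝ) * (t ^ (a.1.val - 1) + (-1 : ℝ) ^ w * t ^ (N - 1 - a.1.val)) / (1 - t ^ N)

/-- **K3 (reduction half, calculus only).** Every symmetric representation is KZ-equivalent to a
normal form on the primitive symmetric basis (dilations `xᵢ ↦ xᵢᵐ`, `m ∣ N`, = the distribution
relations, item `DilationMove` PROVED; partial fractions = rule 1b; polynomial part by Jacobian
monomials `(k+1)^w t^k`). [Milnor 1983 §1; Kubert 1979; Lang 1990 Ch. 2 §8–9] -/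
def SymReduction : Prop :=
  ∀ (w N : ℕ), 2 ≤ w → 3 ≤ N → ∀ (r : KZ.IntegralRep w), IsSymRep w N r →
    ∃ (c : ℚ) (μ : PrimHalf N → ℚ) (r' : KZ.IntegralRep w), r'.domain = box w ∧
      EqOn r'.integrand (fun x => nfIntegrand w N c μ (tOf x)) r'.domain ∧ KZ.Equivalent r r'

/-- **K4 (rigidity half).** Two normal forms with equal values coincide. [folklore; from K2] -/
def SymRigidity : Prop :=
  ∀ (w N : ℕ), 2 ≤ w → 3 ≤ N → ∀ (c c' : ℚ) (μ μ' : PrimHalf N → ℚ) (r r' : KZ.IntegralRep w),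
    r.domain = box w → EqOn r.integrand (fun x => nfIntegrand w N c μ (tOf x)) r.domain →
    r'.domain = box w → EqOn r'.integrand (fun x => nfIntegrand w N c' μ' (tOf x)) r'.domain →
    r.value = r'.value → c = c' ∧ μ = μ'

/-- The odd-weight level-2 sector (the shape of the crux's antecedent `AperySectorThreeTwo`, at any
weight `w`): values in `ℚ + ℚ ζ(w)`. [folklore] -/
def OddLevelTwoSector (w : ℕ) : Prop :=
  ∀ (r r' : KZ.IntegralRep w) (P P' : Polynomial ℚ), r.domain = box w → r'.domain = box w →
    EqOn r.integrand (fun x => Polynomial.aeval (tOf x) P / (1 - (tOf x) ^ 2)) r.domain →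
    EqOn r'.integrand (fun x => Polynomial.aeval (tOf x) P' / (1 - (tOf x) ^ 2)) r'.domain →
    r.value = r'.value → KZ.Equivalent r r'

/-- **Uniform odd-weight rung** (parity ledger, case "open part of rank one"): at level 2 and odd
weight the whole rung costs exactly `ζ(w) ∉ ℚ`. [folklore; Apéry-sector proof with `w` a parameter] -/
def UniformOddLevelTwo : Prop :=
  ∀ (w : ℕ), Odd w → 3 ≤ w → Irrational (zetaValue w) → OddLevelTwoSector w

/-- **Disjunctive rungs from a non-constructive input** (tree fact `zudilin`, periods.S20). [Zudilin 2001] -/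
def zudilinRungs : Prop :=
  OddLevelTwoSector 5 ∨ OddLevelTwoSector 7 ∨ OddLevelTwoSector 9 ∨ OddLevelTwoSector 11

/-- The disjunction follows from the uniform rung and Zudilin's theorem (two lines). [folklore] -/
theorem zudilinRungs_of (hU : UniformOddLevelTwo) (hZ : zudilin) : zudilinRungs := by
  rcases hZ with h | h | h | h
  · exact Or.inl (hU 5 (by decide) (by norm_num) h)
  · exact Or.inr (Or.inl (hU 7 (by decide) (by norm_num) h))
  · exact Or.inr (Or.inr (Or.inl (hU 9 (by decide) (by norm_num) h)))
  · exact Or.inr (Or.inr (Or.inr (hU 11 (by decide) (by norm_num) h)))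

/-- **Existential rungs** (tree fact `infinite_setOf_irrational_zetaValue_odd`, Ball–Rivoal):
Conjecture 1 holds on infinitely many rungs `(2k+1, 2)`. [Ball–Rivoal 2001] -/
theorem infinite_rungs_of (hU : UniformOddLevelTwo) (hB : infinite_setOf_irrational_zetaValue_odd) :
    {k : ℕ | OddLevelTwoSector (2 * k + 1)}.Infinite := by
  refine Set.Infinite.mono (fun k hk => ?_) (hB.diff (Set.finite_singleton 0))
  simp only [mem_diff, mem_setOf_eq, mem_singleton_iff] at hk
  exact hU _ (odd_two_mul_add_one k) (by omega) hk.1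

/-! ## §2 Idea `chebyshev-level-deformation` -/

/-- Chebyshev-T generating kernel `Σ_{n≥1} cos(nu) s^{n−1} = (c − s)/(1 − 2cs + s²)`, `c = cos u`. [folklore] -/
def chebT (c s : ℝ) : ℝ := (c - s) / (1 - 2 * c * s + s ^ 2)

/-- Chebyshev-U generating kernel `Σ_{n≥1} sin(nu) s^{n−1} = √(1−c²)/(1 − 2cs + s²)`, `c = cos u`. [folklore] -/
def chebU (c s : ℝ) : ℝ := Real.sqrt (1 - c ^ 2) / (1 - 2 * c * s + s ^ 2)

/-- The certificate identity behind the ladder: `∂_c T = ∂_s (s / (1 − 2cs + s²))` (both sides equal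
`(1 − s²)/(1 − 2cs + s²)²`), i.e. the 1-form `T ds + (s/(1−2cs+s²)) dc = d(−½ log(1 − 2cs + s²))` is
closed; the calculus uses only its two RATIONAL components. [folklore] -/
theorem certificate (c s : ℝ) (h : 1 - 2 * c * s + s ^ 2 ≠ 0) :
    HasDerivAt (fun c' => chebT c' s) ((1 - s ^ 2) / (1 - 2 * c * s + s ^ 2) ^ 2) c ∧
    HasDerivAt (fun s' => s' / (1 - 2 * c * s' + s' ^ 2)) ((1 - s ^ 2) / (1 - 2 * c * s + s ^ 2) ^ 2) s := by
  constructor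
  · show HasDerivAt (fun c' : ℝ => (c' - s) / (1 - 2 * c' * s + s ^ 2)) _ c
    have h1 : HasDerivAt (fun y : ℝ => y - s) 1 c := (hasDerivAt_id' c).sub_const s
    have ha : HasDerivAt (fun y : ℝ => 2 * y * s) (2 * 1 * s) c :=
      ((hasDerivAt_id' c).const_mul 2).mul_const s
    have h2 : HasDerivAt (fun y : ℝ => 1 - 2 * y * s + s ^ 2) (-(2 * 1 * s)) c :=
      (ha.const_sub 1).add_const (s ^ 2)
    exact (h1.div h2 h).congr_deriv (by ring)
  · have h1 : HasDerivAt (fun y : ℝ => y) 1 s := hasDerivAt_id' s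
    have ha : HasDerivAt (fun y : ℝ => 2 * c * y) (2 * c * 1) s := (hasDerivAt_id' s).const_mul (2 * c)
    have hb : HasDerivAt (fun y : ℝ => y ^ 2) (2 * s) s := by simpa using hasDerivAt_pow 2 s
    have h2 : HasDerivAt (fun y : ℝ => 1 - 2 * c * y + y ^ 2) (-(2 * c * 1) + 2 * s) s :=
      (ha.const_sub 1).add hb
    exact (h1.div h2 h).congr_deriv (by ring)

/-- The band `box^{k+1} × [c₀, 1)` in dimension `k + 2` (parameter `c` = last coordinate). [folklore] -/
def band (k : ℕ) (c₀ : ℝ) : Set (Fin (k + 2) → ℝ) :=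
  {z | (∀ i : Fin (k + 1), z (Fin.castSucc i) ∈ Ioo (0:ℝ) 1) ∧ z (Fin.last (k + 1)) ∈ Ico c₀ 1}

/-- Product of the box coordinates of a band point. [folklore] -/
def pOf {k : ℕ} (z : Fin (k + 2) → ℝ) : ℝ := ∏ i : Fin (k + 1), z (Fin.castSucc i)

/-- **L1 (ladder step, T-family).** For real algebraic `c₀ ∈ [−1, 1)` and `w = k + 2 ≥ 2`:
`[box^w, T(c₀, t)] − [box^w, 1/(1−t)] + [box^{w−1} × [c₀,1), 1/(1 − 2c·p + p²)] ∈ KZ.relations`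
(values `C_w(θ) − ζ(w) + ∫₀^θ S_{w−1}(u) du = 0`, `c₀ = cos θ`). Chain: one Newton–Leibniz move in
the parameter `c` on `box^w × [c₀, 1]` with the rational primitive `T(c, t)` itself, the change of
variables `(x', x_w) ↦ (x', s = p·x_w)`, one Newton–Leibniz move in `s` with the rational primitive
`s/(1 − 2cs + s²)/p` (`certificate`). [folklore] -/
def LadderStepT : Prop :=
  ∀ (k : ℕ) (c₀ : ℝ), IsAlgebraic ℚ c₀ → -1 ≤ c₀ → c₀ < 1 →
    ∀ (r r₁ b : KZ.IntegralRep (k + 2)),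
      r.domain = box (k + 2) → EqOn r.integrand (fun x => chebT c₀ (tOf x)) r.domain →
      r₁.domain = box (k + 2) → EqOn r₁.integrand (fun x => 1 / (1 - tOf x)) r₁.domain →
      b.domain = band k c₀ →
      EqOn b.integrand (fun z => 1 / (1 - 2 * z (Fin.last (k + 1)) * pOf z + (pOf z) ^ 2)) b.domain →
      KZ.of r - KZ.of r₁ + KZ.of b ∈ KZ.relations

/-- **L2 (ladder step, U-family).** For real algebraic `c₀ ∈ [−1, 1)` and `w = k + 2 ≥ 2`:
`[box^w, U(c₀, t)] ~ [box^{w−1} × [c₀,1), T(c, p)/√(1−c²)]` (values `S_w(θ) = ∫₀^θ C_{w−1}(u) du`);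
same three moves with the semialgebraic primitive `−s·T(c,s)/(p√(1−c²))`. [folklore] -/
def LadderStepU : Prop :=
  ∀ (k : ℕ) (c₀ : ℝ), IsAlgebraic ℚ c₀ → -1 ≤ c₀ → c₀ < 1 →
    ∀ (r b : KZ.IntegralRep (k + 2)),
      r.domain = box (k + 2) → EqOn r.integrand (fun x => chebU c₀ (tOf x)) r.domain →
      b.domain = band k c₀ →
      EqOn b.integrand
        (fun z => chebT (z (Fin.last (k + 1))) (pOf z) / Real.sqrt (1 - z (Fin.last (k + 1)) ^ 2))
        b.domain →
      KZ.Equivalent r b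

/-- **L3 (the logarithmic bottom is the hub's Clausen arc; all data over ℚ).** Catalan's box
representation `∫∫_{(0,1)²} dx dy/(1 + x²y²) = G = Cl₂(π/2)` against the two (positive / negative)
parts of the unfolded Clausen arc `−∫₀^{π/2} log(2 sin(φ/2)) dφ` in the coordinates
`t = tan(φ/2)`, `u` (the shape of K2SymbolChains' `ClausenPiVanishes`):
`[box², 1/(1+(xy)²)] − [p₊] + [p₋] ∈ KZ.relations`. Chain: L2 at `c₀ = 0`, `k = 0`; half-angle
`c = (1−t²)/(1+t²)`; split at `x = c` and `u = 1 − 2cx + x²` on each cell. [folklore] -/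
def CatalanClausenJunction : Prop :=
  ∀ (rG pPlus pMinus : KZ.IntegralRep 2),
    rG.domain = box 2 → EqOn rG.integrand (fun x => 1 / (1 + (x 0 * x 1) ^ 2)) rG.domain →
    pPlus.domain = {v | 0 < v 0 ∧ v 0 < 1 ∧ 4 * v 0 ^ 2 / (1 + v 0 ^ 2) < v 1 ∧ v 1 < 1} →
    EqOn pPlus.integrand (fun v => 1 / ((1 + v 0 ^ 2) * v 1)) pPlus.domain →
    pMinus.domain = {v | 0 < v 0 ∧ v 0 < 1 ∧ 1 < v 1 ∧ v 1 < 4 * v 0 ^ 2 / (1 + v 0 ^ 2)} →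
    EqOn pMinus.integrand (fun v => 1 / ((1 + v 0 ^ 2) * v 1)) pMinus.domain →
    KZ.of rG - KZ.of pPlus + KZ.of pMinus ∈ KZ.relations

/-- **L4 (first ℚ̄-twisted instance outside the box tower; both representations ℚ-RATIONAL).**
Level 5, weight 2: `∫_{(0,1)² × (0, sin²(π/5))} 25 (1 + t³)/(1 − t⁵) = sin²(π/5) · (ζ(2,1/5) + ζ(2,4/5)) = π²`
(`sin²(π/5) = (5 − √5)/8`, cut out over ℚ by `0 < z`, `8z < 5`, `(8z − 5)² > 5`) against
`∫∫_{(0,1)²} 6/(1 − xy) = π²`. Not reachable by dilations (the identity `(5−√5)(ζ(2,⅕)+ζ(2,⅘)) = 8π²`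
is a Galois relation, not a distribution relation); reached by the ladder (L1 at `c₀ = cos(2π/5),
cos(4π/5)`, circular bottom, arctan addition at `tan(π/5)`). [folklore] -/
def GoldenTwistInstance : Prop :=
  ∀ (r : KZ.IntegralRep 3) (r' : KZ.IntegralRep 2),
    r.domain = {x | x 0 ∈ Ioo (0:ℝ) 1 ∧ x 1 ∈ Ioo (0:ℝ) 1 ∧ 0 < x 2 ∧ 8 * x 2 < 5 ∧ 5 < (8 * x 2 - 5) ^ 2} →
    EqOn r.integrand (fun x => 25 * (1 + (x 0 * x 1) ^ 3) / (1 - (x 0 * x 1) ^ 5)) r.domain →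
    r'.domain = box 2 → EqOn r'.integrand (fun x => 6 / (1 - x 0 * x 1)) r'.domain →
    KZ.Equivalent r r'

/-- **Headline of idea 2 (Bernoulli-parity tower with real-algebraic twists).** For `w = k+2`, every
representation `[box^w × (0, α), λ · K(c₀, t)]` with `K = T` (`w` even) or `K = U` (`w` odd),
`c₀, α, λ` real algebraic, `c₀ ∈ [−1,1]`, `α > 0`, is KZ-equivalent to the standard representation
`[(0,1)^w, q · ∏ 4/(1 + vᵢ²)]` (value `q π^w`) for an explicit real algebraic `q`; hence any two of them
(any weights) with equal values are KZ-equivalent (Lindemann). Stated here in its consequence form. [folklore] -/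
def TwistedParityTower : Prop :=
  ∀ (k k' : ℕ) (c₀ α c₀' α' : ℝ), IsAlgebraic ℚ c₀ → IsAlgebraic ℚ α → IsAlgebraic ℚ c₀' →
    IsAlgebraic ℚ α' → -1 ≤ c₀ → c₀ ≤ 1 → -1 ≤ c₀' → c₀' ≤ 1 → 0 < α → 0 < α' →
    ∀ (r : KZ.IntegralRep (k + 3)) (r' : KZ.IntegralRep (k' + 3)),
      r.domain = {z | (∀ i : Fin (k + 2), z (Fin.castSucc i) ∈ Ioo (0:ℝ) 1) ∧ z (Fin.last (k + 2)) ∈ Ioo 0 α} →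
      EqOn r.integrand (fun z => if Even k then chebT c₀ (∏ i : Fin (k + 2), z (Fin.castSucc i))
        else chebU c₀ (∏ i : Fin (k + 2), z (Fin.castSucc i))) r.domain →
      r'.domain = {z | (∀ i : Fin (k' + 2), z (Fin.castSucc i) ∈ Ioo (0:ℝ) 1) ∧ z (Fin.last (k' + 2)) ∈ Ioo 0 α'} →
      EqOn r'.integrand (fun z => if Even k' then chebT c₀' (∏ i : Fin (k' + 2), z (Fin.castSucc i))
        else chebU c₀' (∏ i : Fin (k' + 2), z (Fin.castSucc i))) r'.domain →
      r.value = r'.value → KZ.Equivalent r r'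

end Summit.KontsevichZagierPeriods.KontsevichZagierPeriods.Cruxes.HurwitzSectorComplement.SketchIdeator2
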